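import Summits.AtomisticToContinuum.BoseEinsteinCondensation.Theses.BECDyadicChaining
import HarnessLib

/-!
# Crux `DyadicCoherenceDefect` (stmt-AtomisticToContinuum-13192), line `registered` (lead c2, kinetic window):
# the registered glue stub `stub_powerLawSuffices` (PS: POWER-LAW HAAR BAND ⇒ S1″)

Supports (does not close) stmt-AtomisticToContinuum-13192.

Proof narrative (elementary glue, no physics).  From the power law `P` we get `c₀ ≤ 1/50` and an
exponent `α > 0`; we answer `S1″` with the same `c₀`, the bracket budget `b = 1/40` (so
`10 c₀ + b ≤ 9/40 < 1/4`) and `ℓ_d = 1`.  Put `P₂ = 2^{α/2} > 1`, `r = P₂⁻¹ < 1` and feed `P` the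
prefactor `ε = q²` with `q = b (1 - r) / P₂`.  For a density `ρ` let `s = c₀ (ρ a)^{-1/2} ≥ 0` be the
window top and take the budget `β_j = q (s/2^j)^{α/2}` on the brackets `j` with `s < 2^{j+1}` and
`β_j = 0` below.  Since `(s/2^j)^{α/2} = s^{α/2} r^j`, `β` is dominated by a geometric sequence, hence
summable, and summing from the first bracket `j₀` (where `s/2^{j₀} < 2`) gives
`Σ β ≤ q 2^{α/2} / (1 - r) = b`.  On a level `m` in bracket `j` above the window
(`2^j ≤ L/2^m < 2^{j+1}`, `s < L/2^m`) the power law reads `T_m − T_{m−1} ≤ q² (s/(L/2^m))^α N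
≤ q² (s/2^j)^α N = β_j² N`, and taking square roots in `ℝ≥0∞` gives the claim.
-/

noncomputable section

open Filter MeasureTheory
open scoped ENNReal NNReal BigOperators

namespace Summit.AtomisticToContinuum.BoseEinsteinCondensation.Cruxes.DyadicCoherenceDefect.Birth

open Literature.MathematicalPhysics.QuantumManyBody.BoseGas
open Summit.AtomisticToContinuum.BoseEinsteinCondensation.Theses

namespace StubPowerLawSuffices

/-! ### Real-analysis helpers: the geometric bracket budget and the `ℝ≥0∞` square root -/

/-- Dyadic scaling of a real power: `((2:ℝ)^j)^(α/2) = (2^(α/2))^j`. [folklore] -/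
theorem two_pow_rpow (α : ℝ) (j : ℕ) : ((2 : ℝ) ^ j) ^ (α / 2) = ((2 : ℝ) ^ (α / 2)) ^ j := by
  rw [← Real.rpow_natCast_mul (by norm_num : (0 : ℝ) ≤ 2), mul_comm ((j : ℕ) : ℝ) (α / 2),
    Real.rpow_mul_natCast (by norm_num : (0 : ℝ) ≤ 2)]

/-- The scaling identity `(s/2^j)^(α/2) = s^(α/2) r^j` with `r = (2^(α/2))⁻¹`. [folklore] -/
theorem div_two_pow_rpow {s : ℝ} (hs : 0 ≤ s) (α : ℝ) (j : ℕ) :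
    (s / 2 ^ j) ^ (α / 2) = s ^ (α / 2) * ((2 : ℝ) ^ (α / 2))⁻¹ ^ j := by
  rw [Real.div_rpow hs (by positivity) (α / 2), two_pow_rpow, inv_pow, div_eq_mul_inv]

/-- **The bracket budget.**  For `s ≥ 0`, `q ≥ 0`, `α > 0` the sequence
`β_j = [s < 2^{j+1}] · q (s/2^j)^{α/2}` is nonnegative, summable, and
`Σ_j β_j ≤ q 2^{α/2} / (1 - 2^{-α/2})`: it vanishes below the first bracket `j₀` with `s < 2^{j₀+1}`
and is the geometric sequence `q (s/2^{j₀})^{α/2} r^i`, `r = 2^{-α/2}`, from there on, with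
`s / 2^{j₀} < 2`. [folklore] -/
theorem budget {s q α : ℝ} {β : ℕ → ℝ} (hs : 0 ≤ s) (hq : 0 ≤ q) (hα : 0 < α)
    (hβ : ∀ j, β j = if s < 2 ^ (j + 1) then q * (s / 2 ^ j) ^ (α / 2) else 0) :
    (∀ j, 0 ≤ β j) ∧ Summable β ∧
      ∑' j, β j ≤ q * 2 ^ (α / 2) / (1 - ((2 : ℝ) ^ (α / 2))⁻¹) := by
  have hP1 : 1 < (2 : ℝ) ^ (α / 2) := Real.one_lt_rpow one_lt_two (by positivity)
  have hP0 : 0 < (2 : ℝ) ^ (α / 2) := by positivity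
  have hr0 : 0 < ((2 : ℝ) ^ (α / 2))⁻¹ := inv_pos.mpr hP0
  have hr1 : ((2 : ℝ) ^ (α / 2))⁻¹ < 1 := inv_lt_one_of_one_lt₀ hP1
  -- nonnegativity
  have h0 : ∀ j, 0 ≤ β j := fun j => by
    rw [hβ]
    split_ifs
    · exact mul_nonneg hq (Real.rpow_nonneg (div_nonneg hs (by positivity)) _)
    · exact le_rfl
  -- domination by the geometric sequence `q s^{α/2} r^j`
  have hdom : ∀ j, β j ≤ q * s ^ (α / 2) * ((2 : ℝ) ^ (α / 2))⁻¹ ^ j := fun j => by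
    rw [hβ]
    split_ifs
    · rw [div_two_pow_rpow hs, mul_assoc]
    · exact mul_nonneg (mul_nonneg hq (Real.rpow_nonneg hs _)) (pow_nonneg hr0.le _)
  have hsum : Summable β :=
    Summable.of_nonneg_of_le h0 hdom ((summable_geometric_of_lt_one hr0.le hr1).mul_left _)
  refine ⟨h0, hsum, ?_⟩
  -- the first bracket `j₀`
  have hex : ∃ j : ℕ, s < 2 ^ (j + 1) := by
    obtain ⟨n, hn⟩ := pow_unbounded_of_one_lt s (one_lt_two : (1 : ℝ) < 2)
    exact ⟨n, hn.trans_le (pow_le_pow_right₀ one_le_two n.le_succ)⟩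
  obtain ⟨j₀, hj₀, hmin⟩ : ∃ j₀ : ℕ, s < 2 ^ (j₀ + 1) ∧ ∀ j, j < j₀ → ¬s < 2 ^ (j + 1) :=
    ⟨Nat.find hex, Nat.find_spec hex, fun j hj => Nat.find_min hex hj⟩
  -- below `j₀` the budget vanishes, from `j₀` on it is geometric
  have hhead : ∀ j ∈ Finset.range j₀, β j = 0 := fun j hj => by
    rw [hβ, if_neg (hmin j (Finset.mem_range.mp hj))]
  have htail : ∀ i, β (i + j₀) =
      q * (s / 2 ^ j₀) ^ (α / 2) * ((2 : ℝ) ^ (α / 2))⁻¹ ^ i := fun i => by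
    have hi : s < 2 ^ (i + j₀ + 1) := hj₀.trans_le (pow_le_pow_right₀ one_le_two (by omega))
    rw [hβ, if_pos hi, pow_add, div_mul_eq_div_div_swap,
      div_two_pow_rpow (div_nonneg hs (by positivity)), mul_assoc]
  have hx : q * (s / 2 ^ j₀) ^ (α / 2) ≤ q * 2 ^ (α / 2) := by
    refine mul_le_mul_of_nonneg_left
      (Real.rpow_le_rpow (div_nonneg hs (by positivity)) ?_ (by positivity)) hq
    rw [div_le_iff₀ (by positivity), ← pow_succ']
    exact hj₀.le
  calc ∑' j, β j = ∑ j ∈ Finset.range j₀, β j + ∑' i, β (i + j₀) :=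
        (hsum.sum_add_tsum_nat_add j₀).symm
    _ = ∑' i : ℕ, q * (s / 2 ^ j₀) ^ (α / 2) * ((2 : ℝ) ^ (α / 2))⁻¹ ^ i := by
        rw [Finset.sum_eq_zero hhead, zero_add]
        exact tsum_congr htail
    _ = q * (s / 2 ^ j₀) ^ (α / 2) / (1 - ((2 : ℝ) ^ (α / 2))⁻¹) := by
        rw [tsum_mul_left, tsum_geometric_of_lt_one hr0.le hr1, ← div_eq_mul_inv]
    _ ≤ q * 2 ^ (α / 2) / (1 - ((2 : ℝ) ^ (α / 2))⁻¹) :=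
        div_le_div_of_nonneg_right hx (by linarith)

/-- Squaring the budget dominates the power law on a bracket: for `2^j ≤ D`,
`q² (s/D)^α ≤ (q (s/2^j)^{α/2})²`. [folklore] -/
theorem sq_budget {s D q α : ℝ} {j : ℕ} (hs : 0 ≤ s) (hα : 0 < α) (hD : 2 ^ j ≤ D) :
    q ^ 2 * (s / D) ^ α ≤ (q * (s / 2 ^ j) ^ (α / 2)) ^ 2 := by
  have hj : (0 : ℝ) < 2 ^ j := by positivity
  have hD0 : 0 < D := hj.trans_le hD
  have h2 : α / 2 * ((2 : ℕ) : ℝ) = α := by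
    push_cast
    ring
  rw [mul_pow, ← Real.rpow_mul_natCast (div_nonneg hs hj.le) (α / 2) 2, h2]
  exact mul_le_mul_of_nonneg_left
    (Real.rpow_le_rpow (div_nonneg hs hD0.le) (div_le_div_of_nonneg_left hs hj hD) hα.le)
    (sq_nonneg q)

/-- The square-root step in `ℝ≥0∞`: from `X ≤ E · N` and `E ≤ B²` (`B ≥ 0`) conclude
`X^{1/2} ≤ B · N^{1/2}`. [folklore] -/
theorem sqrt_step {X : ℝ≥0∞} {N : ℕ} {E B : ℝ} (hB : 0 ≤ B) (hEB : E ≤ B ^ 2)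
    (hX : X ≤ ENNReal.ofReal (E * N)) :
    X ^ (1 / 2 : ℝ) ≤ ENNReal.ofReal B * (N : ℝ≥0∞) ^ (1 / 2 : ℝ) := by
  -- adapted from `StubKineticWindowBudget.defect_step`
  -- (Theorems/BECDyadicChainingDyadicCoherenceDefectKineticWindowBudget)
  have hB2 : 0 ≤ B ^ 2 := sq_nonneg B
  calc X ^ (1 / 2 : ℝ) ≤ (ENNReal.ofReal (B ^ 2 * N)) ^ (1 / 2 : ℝ) :=
        ENNReal.rpow_le_rpow (hX.trans (ENNReal.ofReal_le_ofReal
          (mul_le_mul_of_nonneg_right hEB N.cast_nonneg))) (by norm_num)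
    _ = ENNReal.ofReal B * (N : ℝ≥0∞) ^ (1 / 2 : ℝ) := by
        rw [ENNReal.ofReal_mul hB2, ENNReal.mul_rpow_of_nonneg _ _ (by norm_num : (0 : ℝ) ≤ 1 / 2),
          ENNReal.ofReal_natCast, ENNReal.ofReal_rpow_of_nonneg hB2 (by norm_num),
          ← Real.sqrt_eq_rpow, Real.sqrt_sq hB]

end StubPowerLawSuffices

open StubPowerLawSuffices in
/-- **Stub PS (M, glue): the power law suffices** — `PowerLawHaarBand → HaarBandAboveKineticWindow`, both in
expanded form. [folklore] -/
theorem stub_powerLawSuffices :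
    (∀ v : ℝ → ℝ≥0∞, IsRepulsiveFiniteRange v → 0 < scatteringLength v →
      ∃ c₀ α : ℝ, 0 < c₀ ∧ c₀ ≤ 1 / 50 ∧ 0 < α ∧ ∀ ε : ℝ, 0 < ε →
      ∃ ρ₀ : ℝ, 0 < ρ₀ ∧ ∀ ρ : ℝ, 0 < ρ → ρ < ρ₀ → ∀ᶠ N : ℕ in atTop,
        let a : ℝ := (scatteringLength v).toReal
        let L : ℝ := sideLength ρ N
        let φ : (m : ℕ) → (Fin 3 → Fin (2 ^ m)) → EuclideanSpace ℝ (Fin 3) → ℂ := fun m i =>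
          Set.indicator {x : EuclideanSpace ℝ (Fin 3) | ∀ k : Fin 3, x k ∈
              Set.Ioo (((i k : ℕ) : ℝ) * (L / 2 ^ m)) ((((i k : ℕ) : ℝ) + 1) * (L / 2 ^ m))}
            (fun _ => ((Real.sqrt ((L / 2 ^ m) ^ 3))⁻¹ : ℂ))
        ∃ δ : ℝ≥0∞, 0 < δ ∧ ∀ Ψ : TrialState N L, energy v Ψ ≤ groundStateEnergy v N L + δ →
          let T : ℕ → ℝ≥0∞ := fun m => ∑ i : Fin 3 → Fin (2 ^ m), occupation N (φ m i) Ψ.ψ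
          ∀ m : ℕ, 1 ≤ m → c₀ * (ρ * a) ^ (-(1 : ℝ) / 2) < L / 2 ^ m →
            T m - T (m - 1) ≤
              ENNReal.ofReal (ε * (c₀ * (ρ * a) ^ (-(1 : ℝ) / 2) / (L / 2 ^ m)) ^ α * N)) →
    ∀ v : ℝ → ℝ≥0∞, IsRepulsiveFiniteRange v → 0 < scatteringLength v →
      ∃ c₀ b ℓd : ℝ, 0 < c₀ ∧ 0 ≤ b ∧ 10 * c₀ + b < 1 / 4 ∧ 0 < ℓd ∧
      ∃ ρ₀ : ℝ, 0 < ρ₀ ∧ ∀ ρ : ℝ, 0 < ρ → ρ < ρ₀ →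
        ∃ β : ℕ → ℝ, (∀ j, 0 ≤ β j) ∧ Summable β ∧ ∑' j, β j ≤ b ∧ ∀ᶠ N : ℕ in atTop,
          let a : ℝ := (scatteringLength v).toReal
          let L : ℝ := sideLength ρ N
          let φ : (m : ℕ) → (Fin 3 → Fin (2 ^ m)) → EuclideanSpace ℝ (Fin 3) → ℂ := fun m i =>
            Set.indicator {x : EuclideanSpace ℝ (Fin 3) | ∀ k : Fin 3, x k ∈
                Set.Ioo (((i k : ℕ) : ℝ) * (L / 2 ^ m)) ((((i k : ℕ) : ℝ) + 1) * (L / 2 ^ m))}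
              (fun _ => ((Real.sqrt ((L / 2 ^ m) ^ 3))⁻¹ : ℂ))
          ∃ δ : ℝ≥0∞, 0 < δ ∧ ∀ Ψ : TrialState N L, energy v Ψ ≤ groundStateEnergy v N L + δ →
            let T : ℕ → ℝ≥0∞ := fun m => ∑ i : Fin 3 → Fin (2 ^ m), occupation N (φ m i) Ψ.ψ
            ∀ m j : ℕ, 1 ≤ m → ℓd * 2 ^ j ≤ L / 2 ^ m → L / 2 ^ m < ℓd * 2 ^ (j + 1) →
              c₀ * (ρ * a) ^ (-(1 : ℝ) / 2) < L / 2 ^ m →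
              (T m - T (m - 1)) ^ (1 / 2 : ℝ) ≤ ENNReal.ofReal (β j) * (N : ℝ≥0∞) ^ (1 / 2 : ℝ) := by
  intro hP v hv ha
  obtain ⟨c₀, α, hc₀, hc50, hα, H⟩ := hP v hv ha
  -- the constants: `P₂ = 2^{α/2} > 1`, `r = P₂⁻¹ < 1`, `b = 1/40`, `q = b (1 - r) / P₂`, `ε = q²`
  have hP1 : 1 < (2 : ℝ) ^ (α / 2) := Real.one_lt_rpow one_lt_two (by positivity)
  have hP0 : 0 < (2 : ℝ) ^ (α / 2) := by positivity
  have hr1 : ((2 : ℝ) ^ (α / 2))⁻¹ < 1 := inv_lt_one_of_one_lt₀ hP1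
  have h1r : 0 < 1 - ((2 : ℝ) ^ (α / 2))⁻¹ := by linarith
  obtain ⟨q, hq_def, hq⟩ : ∃ q : ℝ,
      q = 1 / 40 * (1 - ((2 : ℝ) ^ (α / 2))⁻¹) / (2 : ℝ) ^ (α / 2) ∧ 0 < q :=
    ⟨_, rfl, div_pos (mul_pos (by norm_num) h1r) hP0⟩
  have hqb : q * 2 ^ (α / 2) / (1 - ((2 : ℝ) ^ (α / 2))⁻¹) = 1 / 40 := by
    rw [hq_def, div_mul_cancel₀ _ hP0.ne', mul_div_assoc, div_self h1r.ne', mul_one]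
  obtain ⟨ρ₀, hρ₀, Hρ⟩ := H (q ^ 2) (by positivity)
  refine ⟨c₀, 1 / 40, 1, hc₀, by norm_num, by linarith, one_pos, ρ₀, hρ₀, fun ρ hρ hρ₁ => ?_⟩
  -- the window top `s = c₀ (ρ a)^{-1/2} ≥ 0` and the budget `β`
  have ha0 : 0 ≤ (scatteringLength v).toReal := ENNReal.toReal_nonneg
  generalize (scatteringLength v).toReal = a at Hρ ha0 ⊢
  obtain ⟨s, hs_def, hs⟩ : ∃ s : ℝ, s = c₀ * (ρ * a) ^ (-(1 : ℝ) / 2) ∧ 0 ≤ s :=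
    ⟨_, rfl, mul_nonneg hc₀.le (Real.rpow_nonneg (mul_nonneg hρ.le ha0) _)⟩
  obtain ⟨hβ0, hβs, hβt⟩ := budget (β := fun j => if s < 2 ^ (j + 1) then q * (s / 2 ^ j) ^ (α / 2) else 0)
    hs hq.le hα (fun _ => rfl)
  refine ⟨fun j => if s < 2 ^ (j + 1) then q * (s / 2 ^ j) ^ (α / 2) else 0, hβ0, hβs,
    hβt.trans_eq hqb, ?_⟩
  -- the per-level step, eventually in `N`
  filter_upwards [Hρ ρ hρ hρ₁] with N hN
  dsimp only at hN ⊢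
  obtain ⟨δ, hδ, HΨ⟩ := hN
  refine ⟨δ, hδ, fun Ψ hΨ m j hm hj1 hj2 hup => ?_⟩
  have h := HΨ Ψ hΨ m hm hup
  rw [← hs_def] at h hup
  have hD : (2 : ℝ) ^ j ≤ sideLength ρ N / 2 ^ m := (one_mul ((2 : ℝ) ^ j)).symm.trans_le hj1
  have hsj : s < 2 ^ (j + 1) := hup.trans (hj2.trans_eq (one_mul _))
  rw [if_pos hsj]
  exact sqrt_step (mul_nonneg hq.le (Real.rpow_nonneg (div_nonneg hs (by positivity)) _))
    (sq_budget hs hα hD) h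

end Summit.AtomisticToContinuum.BoseEinsteinCondensation.Cruxes.DyadicCoherenceDefect.Birth

end
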